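import Summits.Ventures.Crystal3D.Theorems.StickyWulffConstantNoReconstructionGainExactDefs
import Summits.Ventures.Crystal3D.Theorems.StickyWulffConstantNoReconstructionGainLatticeAdhesion
import HarnessLib

/-!
# Exact zero gain from the absence of criminals (line `replication-exactness`, stub PEEL)

HONEST FRAMING. Part of the venture `Summits/Ventures/Crystal3D` (cell `crystal3d-full`), supports the
crux `NoReconstructionGain` (stmt-Ventures-19144, route `route-Ventures-StickyWulffConstant`), line
`replication-exactness` (skeleton v2, lead wulff-p1 g17; objects in `…NoReconstructionGainExactDefs`).
This file lands the registered stub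

* `stub_exactZeroGain_of_noCriminal : NoCriminal → ExactZeroGain` — if no CRIMINAL exists (no nonempty
  film on a rigid half-crystal face all of whose nonempty sub-blocks are strictly over-attached), then
  every film has exact zero gain `X(H,Q) ≤ D(Q)`.

Proof (peeling, strong induction on the film): a nonempty film `Q` is not a criminal, so some nonempty
block `U ⊆ Q` satisfies `X(H,U) + e(Q∖U,U) ≤ D(U)`; the sub-film `Q ∖ U` has `X(H,Q∖U) ≤ D(Q∖U)` by
induction (`IsFilmOn.subset`); and `D(Q) = D(Q∖U) + D(U) − e(Q∖U,U)` (`contactDeficiency_sdiff_split`)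
together with the additivity `X(H,Q) = X(H,Q∖U) + X(H,U)` (`plugCount_sdiff_add`) closes the step.

WHAT THIS IS NOT: the existence of criminals is the crux proper (`stub_noCriminal`, open); rung F-C1
not moved.
-/

noncomputable section

namespace Summit.Ventures.Crystal3D.Theorems

open Literature.MathematicalPhysics.StatisticalMechanics (fccStacking contactDeficiency orderedContacts)
open scoped InnerProductSpace
open Finset

/-- A sub-block of a film is a film. -/
theorem IsFilmOn.subset {ν : EuclideanSpace ℝ (Fin 3)} {s : ℝ} {Q U : Finset (EuclideanSpace ℝ (Fin 3))}
    (hQ : IsFilmOn ν s Q) (hU : U ⊆ Q) : IsFilmOn ν s U :=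
  ⟨fun q hq q' hq' hne => hQ.1 q (hU hq) q' (hU hq') hne, fun q hq p hp => hQ.2 q (hU hq) p hp⟩

/-- The plug count is additive over a block and its complement. -/
theorem plugCount_sdiff_add {ν : EuclideanSpace ℝ (Fin 3)} {s : ℝ} {Q U : Finset (EuclideanSpace ℝ (Fin 3))}
    (hU : U ⊆ Q) : plugCount ν s (Q \ U) + plugCount ν s U = plugCount ν s Q := by
  classical
  unfold plugCount
  exact Finset.sum_sdiff hU

/-- The deficiency of the empty configuration vanishes. -/
theorem contactDeficiency_empty : contactDeficiency (∅ : Finset (EuclideanSpace ℝ (Fin 3))) = 0 := by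
  classical
  unfold contactDeficiency orderedContacts
  simp

/-- **STUB `stub_exactZeroGain_of_noCriminal` of the line `replication-exactness` (S): peeling.**  If no
criminal exists then every film has exact zero gain: a nonempty film is not a criminal, so some nonempty
block `U` is not strictly over-attached, `X(H,U) + e(Q∖U,U) ≤ D(U)`; by induction `X(H,Q∖U) ≤ D(Q∖U)`,
and `D(Q) = D(Q∖U) + D(U) − e(Q∖U,U)` (`contactDeficiency_sdiff_split`) with the additivity of `X`. -/
theorem stub_exactZeroGain_of_noCriminal : NoCriminal → ExactZeroGain := by
  classical
  intro hNC ν hν s Q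
  induction Q using Finset.strongInduction with
  | H Q ih =>
    intro hQ
    by_cases hne : Q.Nonempty
    · -- `Q` is not a criminal: pick a block that is not strictly over-attached
      have hnc := hNC ν hν s Q
      unfold IsCriminal at hnc
      push Not at hnc
      obtain ⟨U, hUQ, hUne, hU⟩ := hnc hQ hne
      have hlt : Q \ U ⊂ Q := by
        refine Finset.sdiff_ssubset hUQ hUne
      have ih' := ih (Q \ U) hlt (hQ.subset Finset.sdiff_subset)
      have hsplit := contactDeficiency_sdiff_split (X := Q) (P := Q \ U) Finset.sdiff_subset
      rw [Finset.sdiff_sdiff_eq_self hUQ] at hsplit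
      have hadd := plugCount_sdiff_add (ν := ν) (s := s) hUQ
      have hcast : (plugCount ν s Q : ℝ) = plugCount ν s (Q \ U) + plugCount ν s U := by
        rw [← hadd]; push_cast; ring
      rw [hcast, hsplit]
      linarith
    · rw [Finset.not_nonempty_iff_eq_empty] at hne
      subst hne
      simp [plugCount, contactDeficiency_empty]

end Summit.Ventures.Crystal3D.Theorems

end
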